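import Literature.IUT.HodgeArakelov.CohomologyLimitKummerTorsion
import Literature.IUT.HodgeArakelov.ThetaEnvDataRecordModel
import Literature.IUT.HodgeArakelov.BadPrimeGaussianMonoidsCohomologyModelSectionsProofs
import Literature.IUT.HodgeArakelov.BadPrimeGaussianMonoidsCohomologyModelProofs3
import Mathlib.GroupTheory.OrderOfElement
import Mathlib.GroupTheory.Divisible

/-!
# [IUTchII] Cor 3.5 (ii) / Cor 3.6 (ii) at the `∞`-level: the junction binder `hΘU` ("Galois moves an `N`-th root of
# `θ` by a UNIT") from print's root condition, and the SATURATION of `M^×_TM` in the ambient module — abstract, at the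
# Kummer model, and AT THE GENUINE RECORD `EtaleLevels.thetaEnvRecordKummer` (proof-only)

S. Mochizuki, *Inter-universal Teichmüller theory II*, kurims Dec-2020 manuscript: Cor 3.5 (ii) p. 95 (bracket l. 3–7 on
the writer's render paper:url-5036b4059555: the `N`-th roots that arise by restriction "are uniquely determined, up to
multiplication by an element of the `N`-torsion subgroup of `Ψ^×_cns(M^Θ_*)_{⟨F_l^⋇⟩}`"), Prop 1.4 p. 27 (`∞θ`: "some
positive power coincides, up to torsion, with an element of `θ`"), Prop 3.1 (ii) p. 88 ("`Ψ_cns(M^Θ_*) := M_TM(M^Θ_*)` …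
naturally isomorphic to `𝒪^▷_{F̄_v}`"), Cor 3.6 (ii) p. 100 [cite: Mochizuki2012, Cor 3.5 (ii) p.95]; classically
(`A = k̄ˣ`): `k̄ˣ` is divisible, the torsion of `lim_{k′} H¹(G_{k′}, Ẑ(1))` is `κ(μ(k̄))`
[cite: NeukirchSchmidtWingberg2008, II §7], and `𝒪_{k̄}` is integrally closed in `k̄` (an element of `k̄ˣ` a power of
which is a unit of `𝒪_{k̄}` is a unit of `𝒪_{k̄}`). Claim key DISPUTED (D-0012); nothing disputed is asserted here.
PROOF-ONLY companion (abc-iut cell, layer L6, seat abc-iut-w5-d192 gen 3; node **IUTchII:Cor3.6(ii)** «↷» at the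
`∞`-level — sub-DAG `plan/L6/SUBDAG-IUTchII-Cor-36.md` row Cor-36.ii.r9 — and the `∞`-level of NODES IUTchII:Cor3.5(ii)).
NO definition, NO `Prop` fact; hypotheses inline in Mathlib vocabulary.

THE BINDER. abc-iut-w5-d131's `inftyThetaMonoid_conjStable_of_kummer` (p416348; "`∞Ψ^ι_env` is conjugation-stable") —
consumed by abc-iut-w5-d192's Cor 3.6 (ii) `∞`-level theorem `comap_piIso_map_inftyThetaMonoid_diagonalStable_upToTorsion`
(p420309) — carries `hΘU : ∀ g t, ∀ ϑ ∈ ∞θ^ι_env, ∃ u ∈ M^×_TM, conj (s_t g) ϑ = u · ϑ`. THIS FILE: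
* §1 (ABSTRACT record `E`, `TemperedThetaMonoids.ThetaEnvData.hThetaU_of_hroots`): `hΘU` follows from print's root
  condition `hroots : ∀ ϑ ∈ ∞θ^ι_env, ∃ N > 0, ϑ ^ N ∈ M^×_TM · θ^ℕ` (a THEOREM at the bridge record: abc-iut-w4-d004
  `hroots_toRecord` p427094; abc-iut-w5-d192 `hroots_toRecord_of_horb`), `hfix : conj g θ = θ` (a theorem at the model,
  abc-iut-w4-d004 `conj_section_eq_self_labelwise`), conjugation-stability of `M^×_TM` (Prop 3.1 (ii)), and the
  SATURATION `hsat : x ^ N ∈ M^×_TM ⇒ x ∈ M^×_TM` (`0 < N`): `(conj g ϑ · ϑ⁻¹)^N = conj g u · u⁻¹ ∈ M^×_TM`.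
* §2 (KUMMER MODEL, the setting of abc-iut-w4-d004's `…TorsionUnitsModelProofs`: ambient module identified by `ψ` with
  the genuine limit `lim_K H¹(N ⊓ K, A')`, `Ψ_cns = κ(O)` for a submonoid `O` of the discrete ROOTABLE module `A` through
  abc-iut-w4-d007's `h1LimKummer`, bijective cyclotome coefficients `c`): **`hsat` HOLDS**
  (`units_of_pow_mem_units_ofKummerModel`) as soon as `O` contains the torsion of `A` (roots of unity are integers) and is
  ROOT-CLOSED in `A` (`hOroot : a ^ n ∈ O ⇒ a ∈ O`, `0 < n` — `𝒪_{k̄}` integrally closed): if `x ^ n = κ(a)`, take an `n`-th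
  root `b` of `a` in `A`; `ψ x / κ(b)` is `n`-torsion, hence `κ(ζ)` for a root of unity `ζ` (abc-iut-w5-d098
  `exists_h1LimKummer_eq_of_isOfFinAddOrder`); so `ψ x = κ(b ζ)` with `(b ζ)^n = a ζ^n ∈ O`.
* §3 (GENUINE RECORD `EtaleLevels.thetaEnvRecordKummer … c hA hfi O ι₀` of abc-iut-w4-d019, `ψ = id`, `κ = h1LimKummerOn`
  by `rfl`): `hsat_thetaEnvRecordKummer`, and **`hThetaU_thetaEnvRecordKummer`** — the binder `hΘU` for every family of
  evaluation sections `s_t : Π₀ → Π^tp_{X̲̲}` with images in `Π^tp_{Ÿ̲̲}` and every `θ ∈ θ^{i₀}_env(𝕄_*)`, with inputs = model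
  data (`hc`, `hO`, `hOtors`, `hOroot`) + print's root condition `hroots` relative to `θ` (itself a theorem of the model
  by p427094 given the Prop 2.2 (ii)′ datum); `hfix` and the unit-stability are DERIVED (abc-iut-w4-d004
  `conj_section_eq_self_labelwise` / `toRecord_topClass` / abc-iut-w4-d019 `units_stable_thetaEnvRecord`).
HONEST FRAMING: classical Kummer-theory bookkeeping over the cell's own objects; it removes one `∞`-level junction binder
of NODES IUTchII:Cor3.6 / Cor3.5(ii) in favour of model data; it discharges no disputed claim and takes no side on
[IUTchIII] Cor 3.12; typed ≠ proved ≠ endorsed.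
-/

noncomputable section

namespace Literature.IUT.HodgeArakelov

universe u v

/-! ### §1. Abstract: `hΘU` from `hroots` + `hfix` + unit-stability + saturation -/

namespace TemperedThetaMonoids

namespace ThetaEnvData

variable {P : Type u} [Group P] (E : ThetaEnvData.{u, v} P)

/-- If `ϑ ^ N ∈ M^×_TM · θ^ℕ`, `conj g θ = θ` and `M^×_TM` is `conj g`-stable, then `(conj g ϑ · ϑ⁻¹) ^ N ∈ M^×_TM`:
writing `ϑ ^ N = u · θ ^ k`, `(conj g ϑ · ϑ⁻¹) ^ N = conj g u · u⁻¹`. ([IUTchII] Cor 3.5 (ii) bracket p. 95: the Galois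
conjugate of an `N`-th root is again an `N`-th root of the same element up to units.)
[cite: Mochizuki2012, Cor 3.5 (ii) p.95] -/
theorem conj_mul_inv_pow_mem_units_of_mem_splitMonoid (g : P) {θ ϑ : E.H} {N : ℕ}
    (hϑ : ϑ ^ N ∈ splitMonoid E.units (Submonoid.powers θ)) (hfix : E.conj g θ = θ)
    (hunits : ∀ u ∈ E.units, E.conj g u ∈ E.units) : (E.conj g ϑ * ϑ⁻¹) ^ N ∈ E.units := by
  obtain ⟨u, hu, s, hs, hus⟩ := (mem_splitMonoid_iff _ _ _).1 hϑ
  obtain ⟨k, rfl⟩ := (Submonoid.mem_powers_iff _ _).1 hs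
  have hq : (E.conj g ϑ * ϑ⁻¹) ^ N = E.conj g u * u⁻¹ := by
    rw [mul_pow, inv_pow, ← map_pow, ← hus, map_mul, map_pow, hfix, mul_inv_rev, mul_assoc, mul_inv_cancel_left]
  rw [hq]
  exact E.units.mul_mem (hunits u hu) (E.units.inv_mem hu)

/-- **`hΘU` from print's root condition** ([IUTchII] Cor 3.5 (ii) p. 95 bracket; the binder `hΘU` of abc-iut-w5-d131's
`inftyThetaMonoid_conjStable_of_kummer`, p416348, for ONE group element `g` — consumers take `g := s_t g'`): for every
`ϑ ∈ ∞θ^ι_env` there is `u ∈ M^×_TM` with `conj g ϑ = u · ϑ`, GIVEN `hroots` (every `ϑ ∈ ∞θ^ι_env` has a positive power in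
`M^×_TM · θ^ℕ`), `hfix : conj g θ = θ`, `conj g`-stability of `M^×_TM`, and the saturation `hsat` of `M^×_TM` in the ambient
module (`x ^ N ∈ M^×_TM`, `0 < N` ⇒ `x ∈ M^×_TM`). [cite: Mochizuki2012, Cor 3.5 (ii) p.95] -/
theorem hThetaU_of_hroots (ι : E.Iota) {θ : E.H} (g : P)
    (hroots : ∀ ϑ ∈ E.inftyThetaEnv ι, ∃ N : ℕ, 0 < N ∧ ϑ ^ N ∈ splitMonoid E.units (Submonoid.powers θ))
    (hfix : E.conj g θ = θ) (hunits : ∀ u ∈ E.units, E.conj g u ∈ E.units)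
    (hsat : ∀ (x : E.H) (N : ℕ), 0 < N → x ^ N ∈ E.units → x ∈ E.units) :
    ∀ ϑ ∈ E.inftyThetaEnv ι, ∃ u ∈ E.units, E.conj g ϑ = u * ϑ := by
  intro ϑ hϑ
  obtain ⟨N, hN, hmem⟩ := hroots ϑ hϑ
  exact ⟨E.conj g ϑ * ϑ⁻¹,
    hsat _ N hN (E.conj_mul_inv_pow_mem_units_of_mem_splitMonoid g hmem hfix hunits),
    by rw [inv_mul_cancel_right]⟩

/-- The same in the labeled binder shape of the consuming files
(`∀ g t, ∀ ϑ ∈ ∞θ^ι_env, ∃ u ∈ M^×_TM, conj (s_t g) ϑ = u · ϑ`), from `hfix : ∀ g t, conj (s_t g) θ = θ` and full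
conjugation-stability of `M^×_TM`. [cite: Mochizuki2012, Cor 3.5 (ii) p.95] -/
theorem hThetaU_of_hroots_labelwise {G : Type*} {T : Type*} (s : T → (G → P)) (ι : E.Iota) {θ : E.H}
    (hroots : ∀ ϑ ∈ E.inftyThetaEnv ι, ∃ N : ℕ, 0 < N ∧ ϑ ^ N ∈ splitMonoid E.units (Submonoid.powers θ))
    (hfix : ∀ g t, E.conj (s t g) θ = θ) (hunits : ∀ (p : P), ∀ u ∈ E.units, E.conj p u ∈ E.units)
    (hsat : ∀ (x : E.H) (N : ℕ), 0 < N → x ^ N ∈ E.units → x ∈ E.units) :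
    ∀ g t, ∀ ϑ ∈ E.inftyThetaEnv ι, ∃ u ∈ E.units, E.conj (s t g) ϑ = u * ϑ :=
  fun g t => E.hThetaU_of_hroots ι (s t g) hroots (hfix g t) (hunits (s t g)) hsat

end ThetaEnvData

end TemperedThetaMonoids

/-! ### §2. The Kummer model: `M^×_TM` is saturated in the ambient module -/

namespace BadPrimeGaussianMonoids

open Literature.AnabelianGeometry.EtaleTheta CohomologySystemOfContH1 TemperedThetaMonoids

variable {Q : Type u} [Group Q] (E : TemperedThetaMonoids.ThetaEnvData.{u, v} Q)
  {P : TopGroup.{0}} {G' : Type} [Group G'] [TopologicalSpace G'] [IsTopologicalGroup G']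
  (φ : P →* G') (A' : Subgroup G') [A'.Normal] [IsMulCommutative A'] (N : Subgroup P)
  {A : Type} [CommGroup A] [MulDistribMulAction P A] [TopologicalSpace A] [RootableBy A ℕ]
  (c : CyclotomeCoefficients φ A' A) (hA : ∀ b : A, IsOpen (MulAction.stabilizer P b : Set P))
  (hfi : ∀ b : A, (MulAction.stabilizer P b).FiniteIndex)
  (ψ : E.H ≃* Multiplicative (h1Lim φ A' N ⊥)) (O : Submonoid A) (κO : O →* E.H)

/-- **An element of the ambient module a positive power of which is a Kummer class `κ(a)`, `a ∈ O`, is itself a Kummer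
class `κ(m)`, `m ∈ O`** — at the Kummer model (`ψ`, `hκO`), for bijective cyclotome coefficients (`hc`), `O` containing the
torsion of `A` (`hO`) and root-closed in `A` (`hOroot`). Proof: an `n`-th root `b` of `a` in the rootable `A`; `ψ x / κ(b)`
is `n`-torsion, hence `κ(ζ)` with `ζ` torsion (abc-iut-w5-d098 `exists_h1LimKummer_eq_of_isOfFinAddOrder`); `m := b ζ`
has `m ^ n = a ζ^n ∈ O`. [cite: NeukirchSchmidtWingberg2008, II §7] -/
theorem mem_mrange_of_pow_eq_ofKummerModel
    (hκO : ∀ m : O, ψ (κO m) = h1LimKummer φ A' N c hA hfi (m : A)) (hc : Function.Bijective c.hom)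
    (hO : ∀ a : A, IsOfFinOrder a → a ∈ O) (hOroot : ∀ (a : A) (n : ℕ), 0 < n → a ^ n ∈ O → a ∈ O)
    {x : E.H} {n : ℕ} (hn : 0 < n) {a : O} (hx : x ^ n = κO a) : x ∈ MonoidHom.mrange κO := by
  -- an `n`-th root `b` of `a` in the rootable module `A`
  obtain ⟨b, hb⟩ : ∃ b : A, b ^ n = (a : A) := RootableBy.surjective_pow (A := A) (α := ℕ) hn.ne' (a : A)
  -- `ψ x / κ(b)` is `n`-torsion in the limit
  have hpow : (ψ x * (h1LimKummer φ A' N c hA hfi b)⁻¹) ^ n = 1 := by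
    rw [mul_pow, inv_pow, ← map_pow, ← map_pow, hx, hκO, hb, mul_inv_cancel]
  have htor : IsOfFinAddOrder (Multiplicative.toAdd (ψ x * (h1LimKummer φ A' N c hA hfi b)⁻¹)) :=
    (isOfFinOrder_ofAdd_iff (x := Multiplicative.toAdd _)).mp (isOfFinOrder_iff_pow_eq_one.mpr ⟨n, hn, hpow⟩)
  -- hence the Kummer class of a root of unity `ζ`
  obtain ⟨ζ, hζ, hζeq⟩ := exists_h1LimKummer_eq_of_isOfFinAddOrder φ A' N c hA hfi hc _ htor
  have hψx : ψ x = h1LimKummer φ A' N c hA hfi (b * ζ) := by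
    rw [map_mul, hζeq, ofAdd_toAdd, mul_comm (ψ x) _, mul_inv_cancel_left]
  -- `b ζ ∈ O` by root-closure: `(b ζ)^n = a · ζ^n`
  have hbζ : b * ζ ∈ O :=
    hOroot _ n hn (by rw [mul_pow, hb]; exact O.mul_mem a.2 (hO _ hζ.pow))
  refine ⟨⟨b * ζ, hbζ⟩, ψ.injective ?_⟩
  rw [hκO, hψx]

/-- **`M^×_TM` is SATURATED in the ambient module at the Kummer model**: if `x ^ n ∈ M^×_TM` with `0 < n`, then
`x ∈ M^×_TM` — the binder `hsat` of `TemperedThetaMonoids.ThetaEnvData.hThetaU_of_hroots` /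
`ThetaEnvData.hThetaU_toRecord` HOLDS, given bijective cyclotome coefficients, `O ⊇ torsion(A)` and `O` root-closed in `A`.
(`M^×_TM = ` units of `Ψ_cns = κ(O)` by `units_eq`; apply the previous theorem to `x` and to `x⁻¹`.)
[cite: NeukirchSchmidtWingberg2008, II §7] -/
theorem units_of_pow_mem_units_ofKummerModel
    (hκO : ∀ m : O, ψ (κO m) = h1LimKummer φ A' N c hA hfi (m : A))
    (hcns : E.constantMonoid = MonoidHom.mrange κO) (hc : Function.Bijective c.hom)
    (hO : ∀ a : A, IsOfFinOrder a → a ∈ O) (hOroot : ∀ (a : A) (n : ℕ), 0 < n → a ^ n ∈ O → a ∈ O)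
    (x : E.H) (n : ℕ) (hn : 0 < n) (hx : x ^ n ∈ E.units) : x ∈ E.units := by
  rw [E.units_eq] at hx ⊢
  have h1 : x ^ n ∈ MonoidHom.mrange κO := by
    rw [← hcns]; exact hx.1
  have h2 : x⁻¹ ^ n ∈ MonoidHom.mrange κO := by
    rw [← hcns, inv_pow]; exact hx.2
  obtain ⟨a, ha⟩ := h1
  obtain ⟨a', ha'⟩ := h2
  refine ⟨?_, ?_⟩
  · change x ∈ E.constantMonoid
    rw [hcns]
    exact mem_mrange_of_pow_eq_ofKummerModel E φ A' N c hA hfi ψ O κO hκO hc hO hOroot hn ha.symm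
  · change x⁻¹ ∈ E.constantMonoid
    rw [hcns]
    exact mem_mrange_of_pow_eq_ofKummerModel E φ A' N c hA hfi ψ O κO hκO hc hO hOroot hn ha'.symm

/-- The same in binder shape (`hsat : ∀ x N, 0 < N → x ^ N ∈ M^×_TM → x ∈ M^×_TM`).
[cite: NeukirchSchmidtWingberg2008, II §7] -/
theorem hsat_ofKummerModel
    (hκO : ∀ m : O, ψ (κO m) = h1LimKummer φ A' N c hA hfi (m : A))
    (hcns : E.constantMonoid = MonoidHom.mrange κO) (hc : Function.Bijective c.hom)
    (hO : ∀ a : A, IsOfFinOrder a → a ∈ O) (hOroot : ∀ (a : A) (n : ℕ), 0 < n → a ^ n ∈ O → a ∈ O) :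
    ∀ (x : E.H) (n : ℕ), 0 < n → x ^ n ∈ E.units → x ∈ E.units :=
  fun x n hn hx => units_of_pow_mem_units_ofKummerModel E φ A' N c hA hfi ψ O κO hκO hcns hc hO hOroot x n hn hx

end BadPrimeGaussianMonoids

/-! ### §3. AT THE GENUINE RECORD `EtaleLevels.thetaEnvRecordKummer` -/

namespace EtaleLevels

open Literature.AnabelianGeometry.EtaleTheta CohomologySystemOfContH1 EtaleThetaDataOfSetting TemperedThetaMonoids
  BadPrimeGaussianMonoids

variable {p : ℕ} [Fact p.Prime] {D : Literature.AnabelianGeometry.EtaleTheta.ThetaSetting p}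
  {E : D.EtaleThetaData} {l : ℕ} (C : E.DoubleUnderline l) (hC : D.Compat) (hS : D.Sec2Hyps)
  (hl : l.Prime) (hp2 : p ≠ 2) (hpl : p ≠ l) (hζ : ∃ ζ : D.K, IsPrimitiveRoot ζ (4 * l))
  (mods : ∀ M : ℕ+, D.CyclotomeMod l M)
  (f : contCocycles D.toTheta D.DeltaTheta C.GtpYdduu) (hf : f ∈ C.rootCocycles hC)
  (hmods : ∀ (M M' : ℕ+) (h : (M : ℕ) ∣ (M' : ℕ)) (x : D.lDeltaTheta l),
    MuN.red p M M' h ((mods M').red x) = (mods M).red x)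
  (h15 : Literature.AnabelianGeometry.EtaleTheta.ThetaSetting.Prop15iii E hC) (L : C.CuspLabels)
  (hZ : ∀ M : ℕ+, Nonempty (ModelCyclotomes.lDeltaQuot (C.rigidData (mods M) hC hS h15 L) ≃*
    Literature.IUT.HodgeTheaters.ZHat))
  (hcharY : EtaleThetaDataOfSetting.PiYddCharacteristic C)
  (hlim : Function.Bijective (rigidLimHom C hC hS hl hp2 hpl hζ mods f hf hmods h15 L hZ))
  [(EtaleThetaDataOfSetting.PiYdd C).Normal]
  {A : Type} [CommGroup A] [MulDistribMulAction (Pi C) A] [TopologicalSpace A] [RootableBy A ℕ]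
  (c : CyclotomeCoefficients (phi C) (D.lDeltaTheta l) A)
  (hA : ∀ b : A, IsOpen (MulAction.stabilizer (Pi C) b : Set (Pi C)))
  (hfi : ∀ b : A, (MulAction.stabilizer (Pi C) b).FiniteIndex)
  (O : Submonoid A) (hO : ∀ (σ : Pi C) (b : A), b ∈ O → σ • b ∈ O) (ι₀ : Pi C)

/-- **`M^×_TM` of the genuine record is SATURATED in the ambient module `lim_J H¹(Π^tp_{Ÿ̲̲} ∩ J, l·Δ_Θ)`**: if
`x ^ n ∈ M^×_TM` with `0 < n` then `x ∈ M^×_TM` — for bijective cyclotomic-rigidity coefficients `c`, and a constant monoid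
`O` ("`𝒪^▷_{k̄}`") containing the roots of unity and root-closed in `A` ("`k̄ˣ`"). The binder `hsat` of
`ThetaEnvData.hThetaU_toRecord` / `TemperedThetaMonoids.ThetaEnvData.hThetaU_of_hroots` at the genuine record
(identification `ψ = id`, `κ = h1LimKummerOn` by `rfl`). [cite: NeukirchSchmidtWingberg2008, II §7] -/
theorem units_of_pow_mem_units_thetaEnvRecordKummer (hc : Function.Bijective c.hom)
    (hOtors : ∀ a : A, IsOfFinOrder a → a ∈ O ∧ a⁻¹ ∈ O)
    (hOroot : ∀ (a : A) (n : ℕ), 0 < n → a ^ n ∈ O → a ∈ O)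
    (x : (thetaEnvRecordKummer C hC hS hl hp2 hpl hζ mods f hf hmods h15 L hZ hcharY hlim c hA hfi O ι₀).H)
    (n : ℕ) (hn : 0 < n)
    (hx : x ^ n ∈ (thetaEnvRecordKummer C hC hS hl hp2 hpl hζ mods f hf hmods h15 L hZ hcharY hlim c hA hfi O ι₀).units) :
    x ∈ (thetaEnvRecordKummer C hC hS hl hp2 hpl hζ mods f hf hmods h15 L hZ hcharY hlim c hA hfi O ι₀).units :=
  BadPrimeGaussianMonoids.units_of_pow_mem_units_ofKummerModel
    (thetaEnvRecordKummer C hC hS hl hp2 hpl hζ mods f hf hmods h15 L hZ hcharY hlim c hA hfi O ι₀)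
    (phi C) (D.lDeltaTheta l) (PiYdd C) c hA hfi (MulEquiv.refl _) O
    (h1LimKummerOn (phi C) (D.lDeltaTheta l) (PiYdd C) c hA hfi O) (fun _ => rfl)
    (ThetaEnvData.toRecord_constantMonoid _ _ _ _) hc (fun a ha => (hOtors a ha).1) hOroot x n hn hx

/-- The same in binder shape (`hsat : ∀ x N, 0 < N → x ^ N ∈ M^×_TM → x ∈ M^×_TM`) at the genuine record.
[cite: NeukirchSchmidtWingberg2008, II §7] -/
theorem hsat_thetaEnvRecordKummer (hc : Function.Bijective c.hom)
    (hOtors : ∀ a : A, IsOfFinOrder a → a ∈ O ∧ a⁻¹ ∈ O)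
    (hOroot : ∀ (a : A) (n : ℕ), 0 < n → a ^ n ∈ O → a ∈ O) :
    ∀ (x : (thetaEnvRecordKummer C hC hS hl hp2 hpl hζ mods f hf hmods h15 L hZ hcharY hlim c hA hfi O ι₀).H) (n : ℕ),
      0 < n → x ^ n ∈ (thetaEnvRecordKummer C hC hS hl hp2 hpl hζ mods f hf hmods h15 L hZ hcharY hlim c hA hfi O ι₀).units →
        x ∈ (thetaEnvRecordKummer C hC hS hl hp2 hpl hζ mods f hf hmods h15 L hZ hcharY hlim c hA hfi O ι₀).units :=
  fun x n hn hx => units_of_pow_mem_units_thetaEnvRecordKummer C hC hS hl hp2 hpl hζ mods f hf hmods h15 L hZ hcharY hlim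
    c hA hfi O ι₀ hc hOtors hOroot x n hn hx

include hO in
/-- **`hΘU` AT THE GENUINE RECORD** ([IUTchII] Cor 3.5 (ii) p. 95 bracket; the binder `hΘU` of abc-iut-w5-d131's
`inftyThetaMonoid_conjStable_of_kummer` (p416348) / abc-iut-w5-d192's Cor 3.6 (ii) `∞`-level theorem (p420309), in their
labeled shape): for every family of evaluation sections `s_t : Π₀ → Π^tp_{X̲̲}` with images in `Π^tp_{Ÿ̲̲}` (Cor 2.4 (ii)(c)),
every `θ ∈ θ^{i₀}_env(𝕄_*)` and every label `i`: for all `g`, `t` and `ϑ ∈ ∞θ^{i}_env`, `conj (s_t g) ϑ = u · ϑ` with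
`u ∈ M^×_TM`. Inputs = model data (`hc`, `hO`, `hOtors`, `hOroot`) + print's root condition `hroots` on `∞θ^{i}_env` relative
to `θ` (a theorem of the model at `i = i₀` given the Prop 2.2 (ii)′ datum, abc-iut-w4-d004 p427094); `hfix` and the
unit-stability are DERIVED (abc-iut-w4-d004 `conj_section_eq_self_labelwise` / `toRecord_topClass`, abc-iut-w4-d019
`units_stable_thetaEnvRecord`),
`hsat` is `hsat_thetaEnvRecordKummer`. [cite: Mochizuki2012, Cor 3.5 (ii) p.95] -/
theorem hThetaU_thetaEnvRecordKummer (hc : Function.Bijective c.hom)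
    (hOtors : ∀ a : A, IsOfFinOrder a → a ∈ O ∧ a⁻¹ ∈ O)
    (hOroot : ∀ (a : A) (n : ℕ), 0 < n → a ^ n ∈ O → a ∈ O)
    {Lbl : Type*} {P₀ : TopGroup.{0}} (s : Lbl → (P₀ →* Pi C))
    (hN : ∀ t, (⊤ : Subgroup P₀).map ((MonoidHom.id (Pi C)).comp (s t)) ≤ PiYdd C) {i₀ : Pi C}
    {θ : (thetaEnvRecordKummer C hC hS hl hp2 hpl hζ mods f hf hmods h15 L hZ hcharY hlim c hA hfi O ι₀).H}
    (hθ : θ ∈ (thetaEnvRecordKummer C hC hS hl hp2 hpl hζ mods f hf hmods h15 L hZ hcharY hlim c hA hfi O ι₀).thetaEnv i₀)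
    (i : (thetaEnvRecordKummer C hC hS hl hp2 hpl hζ mods f hf hmods h15 L hZ hcharY hlim c hA hfi O ι₀).Iota)
    (hroots : ∀ ϑ ∈ (thetaEnvRecordKummer C hC hS hl hp2 hpl hζ mods f hf hmods h15 L hZ hcharY hlim c hA hfi O ι₀).inftyThetaEnv i,
      ∃ n : ℕ, 0 < n ∧ ϑ ^ n ∈
        splitMonoid (thetaEnvRecordKummer C hC hS hl hp2 hpl hζ mods f hf hmods h15 L hZ hcharY hlim c hA hfi O ι₀).units
          (Submonoid.powers θ)) :
    ∀ (g : P₀) (t : Lbl),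
      ∀ ϑ ∈ (thetaEnvRecordKummer C hC hS hl hp2 hpl hζ mods f hf hmods h15 L hZ hcharY hlim c hA hfi O ι₀).inftyThetaEnv i,
        ∃ u ∈ (thetaEnvRecordKummer C hC hS hl hp2 hpl hζ mods f hf hmods h15 L hZ hcharY hlim c hA hfi O ι₀).units,
          (thetaEnvRecordKummer C hC hS hl hp2 hpl hζ mods f hf hmods h15 L hZ hcharY hlim c hA hfi O ι₀).conj (s t g) ϑ =
            u * ϑ := by
  have hfix : ∀ (g : P₀) (t : Lbl),
      (thetaEnvRecordKummer C hC hS hl hp2 hpl hζ mods f hf hmods h15 L hZ hcharY hlim c hA hfi O ι₀).conj (s t g) θ = θ :=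
    conj_section_eq_self_labelwise
      (thetaEnvRecordKummer C hC hS hl hp2 hpl hζ mods f hf hmods h15 L hZ hcharY hlim c hA hfi O ι₀)
      (phi C) (D.lDeltaTheta l) (PiYdd C) (MonoidHom.id (Pi C))
      (AddEquiv.additiveMultiplicative (h1Lim (phi C) (D.lDeltaTheta l) (PiYdd C) ⊥)) s hN (fun _ _ => rfl)
      -- `θ ∈ θ^{i₀}_env` is a top-level class (abc-iut-w4-d004 `toRecord_topClass`, identity coefficient transport)
      (toRecord_topClass (thetaEnvData C hC hS hl hp2 hpl hζ mods f hf hmods h15 L hZ hcharY hlim)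
        (CohomologySystemOfContH1.h1LimConjMulAut (phi C) (D.lDeltaTheta l) (PiYdd C))
        (h1LimKummerOn (phi C) (D.lDeltaTheta l) (PiYdd C) c hA hfi O)
        (fun g : Pi C => h1LimConjEquiv (phi C) (D.lDeltaTheta l) (PiYdd C) (g * ι₀ * g⁻¹))
        (phi C) (D.lDeltaTheta l) (PiYdd C)
        (AddEquiv.additiveMultiplicative (h1Lim (phi C) (D.lDeltaTheta l) (PiYdd C) ⊥)) (fun y _ => ⟨y, rfl⟩) hθ)
  exact (thetaEnvRecordKummer C hC hS hl hp2 hpl hζ mods f hf hmods h15 L hZ hcharY hlim c hA hfi O ι₀).hThetaU_of_hroots_labelwise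
    (fun t g => s t g) i hroots hfix
    (fun q u hu => units_stable_thetaEnvRecord C hC hS hl hp2 hpl hζ mods f hf hmods h15 L hZ hcharY hlim c hA hfi O hO ι₀
      q u hu)
    (hsat_thetaEnvRecordKummer C hC hS hl hp2 hpl hζ mods f hf hmods h15 L hZ hcharY hlim c hA hfi O ι₀ hc hOtors hOroot)

end EtaleLevels

end Literature.IUT.HodgeArakelov

end
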